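import Literature.Probability.Percolation.FlipResponse
import Literature.Probability.Percolation.SiteEmbDomainCrossing

/-!
# Localisation of the flip response at the quadrilateral (four-arm structure)

Helper file for the crux `QuadrupoleSelectionRule` (stmt-CriticalPhenomena-7029, informal) of route
`CardyFlipRusso` (sub-problem `CardyFormulaZ2`), line `Sketch`: the combinatorial heart of the
"wanted lemma (1)" of `Literature/Probability/Percolation/FlipResponse.lean` — the flip response
of a crossing event is a difference of two FOUR-ARM-type probabilities at the flipped
quadrilateral `Q = ABCD`:

`Δ_Q = P[E_BD] − P[E_AC]`, with `E_BD ⊆ {B, D open, A, C closed}`, `E_AC ⊆ {A, C open, B, D closed}`.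

For site percolation the diagonal flip `AC ↝ BD` changes the open-connectivity of a
configuration `ω` only if the flipped edge is PIVOTAL for `ω`: if `B` or `D` is closed the new
edge `BD` is unusable, and if `A` (or `C`) is open the new edge is short-circuited by the path
`B – A – D` of the quadrilateral; symmetrically for the removed edge `AC`.

## Contents (namespace `Summit.CriticalPhenomena.CardyFormulaZ2.Theorems`)

* `reachable_of_forall_adj_reachable` — reachability transfers along any map of edges to paths;
* `siteOpenGraph_le_of_adj_of_ne`, `siteConnIn_subset_of_adj_of_ne_of_not_mem`,
  `siteConnIn_subset_of_adj_of_ne_of_pivot` — generic comparison of the connection events of two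
  graphs that agree away from one edge `{a, c}`: equal when an endpoint of that edge is closed, or
  when an open pivot `P ∈ S` adjacent to both `a` and `c` exists;
* `crossing_flipGraph_sdiff_subset`, `crossing_sdiff_flipGraph_subset` — for a flippable
  quadrilateral inside the domain `S`, the symmetric difference of the crossing events
  `{∃ u ∈ X, v ∈ Y, u ⟷ v in S}` before/after the flip lies in the four-arm cylinders;
* `flipResponse_eq_real_sdiff_sub` — `Δ_Q(U) = P[U(flip G) ∖ U(G)] − P[U(G) ∖ U(flip G)]` for
  measurable events.

## References

* V. Beffara, *Is critical 2D percolation universal?* (2008), §4.2 Prop. 16, §5.2 Prop. 18.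
* G. Grimmett, *Percolation* (1999), §2.4 (pivotality, Russo's formula).
-/

noncomputable section

open MeasureTheory

namespace Summit.CriticalPhenomena.CardyFormulaZ2.Theorems

open Literature.Probability.Percolation

variable {V : Type*}

/-! ### Reachability transfer -/

/-- If every edge of `H'` joins two `H`-reachable vertices, then `H'`-reachability implies
`H`-reachability (induction on a walk). [folklore] -/
theorem reachable_of_forall_adj_reachable {W : Type*} {H H' : SimpleGraph W}
    (h : ∀ ⦃x y : W⦄, H'.Adj x y → H.Reachable x y) {x y : W} (hxy : H'.Reachable x y) :
    H.Reachable x y := by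
  obtain ⟨p⟩ := hxy
  induction p with
  | nil => exact SimpleGraph.Reachable.refl _
  | cons hadj _ ih => exact (h hadj).trans ih

/-! ### Two graphs that agree away from one edge -/

/-- If `G₂` contains every edge of `G₁` other than `{a, c}` and one endpoint of `{a, c}` is closed
in `ω`, then the `ω`-open subgraph of `G₁` is contained in that of `G₂` (the exceptional edge is
not open). [folklore] -/
theorem siteOpenGraph_le_of_adj_of_ne {G₁ G₂ : SimpleGraph V} {a c : V}
    (hG : ∀ ⦃x y : V⦄, G₁.Adj x y → s(x, y) ≠ s(a, c) → G₂.Adj x y) {ω : SiteConfig V}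
    (hω : a ∉ ω ∨ c ∉ ω) : siteOpenGraph G₁ ω ≤ siteOpenGraph G₂ ω := by
  intro x y hxy
  rw [siteOpenGraph_adj] at hxy ⊢
  obtain ⟨hadj, hx, hy⟩ := hxy
  refine ⟨hG hadj fun hac => ?_, hx, hy⟩
  rcases Sym2.eq_iff.1 hac with ⟨rfl, rfl⟩ | ⟨rfl, rfl⟩
  · exact hω.elim (fun h => h hx) (fun h => h hy)
  · exact hω.elim (fun h => h hy) (fun h => h hx)

/-- Connection events of two graphs agreeing away from the edge `{a, c}` coincide on
configurations in which `a` or `c` is closed (one inclusion; swap the graphs for the other).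
[folklore] -/
theorem siteConnIn_subset_of_adj_of_ne_of_not_mem {G₁ G₂ : SimpleGraph V} {a c : V}
    (hG : ∀ ⦃x y : V⦄, G₁.Adj x y → s(x, y) ≠ s(a, c) → G₂.Adj x y) {ω : SiteConfig V}
    (hω : a ∉ ω ∨ c ∉ ω) {S : Set V} {x y : V} (h : ω ∈ siteConnIn G₁ S x y) :
    ω ∈ siteConnIn G₂ S x y := by
  obtain ⟨hx, hy, hxS, hyS, hr⟩ := h
  exact ⟨hx, hy, hxS, hyS,
    hr.mono (SimpleGraph.comap_monotone _ (siteOpenGraph_le_of_adj_of_ne hG hω))⟩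

/-- **Rerouting through an open pivot.** If `G₂` contains every edge of `G₁` other than `{a, c}`
and there is an open site `P ∈ S` adjacent in `G₂` to both `a` and `c`, then every `G₁`-connection
inside `S` is a `G₂`-connection inside `S`: a step along `{a, c}` is replaced by `a – P – c`.
[folklore] -/
theorem siteConnIn_subset_of_adj_of_ne_of_pivot {G₁ G₂ : SimpleGraph V} {a c : V}
    (hG : ∀ ⦃x y : V⦄, G₁.Adj x y → s(x, y) ≠ s(a, c) → G₂.Adj x y) {ω : SiteConfig V} {S : Set V}
    {P : V} (hP : P ∈ ω) (hPS : P ∈ S) (hPa : G₂.Adj P a) (hPc : G₂.Adj P c) {x y : V}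
    (h : ω ∈ siteConnIn G₁ S x y) : ω ∈ siteConnIn G₂ S x y := by
  obtain ⟨hx, hy, hxS, hyS, hr⟩ := h
  refine ⟨hx, hy, hxS, hyS, reachable_of_forall_adj_reachable (fun u v huv => ?_) hr⟩
  simp only [SimpleGraph.comap_adj, Function.Embedding.coe_subtype, siteOpenGraph_adj] at huv
  obtain ⟨hadj, hu, hv⟩ := huv
  -- adjacency in the target induced open graph, unfolded
  have adj_iff : ∀ (u' v' : S), ((siteOpenGraph G₂ ω).induce S).Adj u' v' ↔
      G₂.Adj u' v' ∧ (u' : V) ∈ ω ∧ (v' : V) ∈ ω := fun u' v' => by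
    simp only [SimpleGraph.comap_adj, Function.Embedding.coe_subtype, siteOpenGraph_adj]
  by_cases hac : s((u : V), (v : V)) = s(a, c)
  · -- the exceptional edge: go through the pivot `P`
    have hPu : G₂.Adj P u ∧ G₂.Adj P v := by
      rcases Sym2.eq_iff.1 hac with ⟨h1, h2⟩ | ⟨h1, h2⟩
      · exact ⟨h1 ▸ hPa, h2 ▸ hPc⟩
      · exact ⟨h1 ▸ hPc, h2 ▸ hPa⟩
    have h1 : ((siteOpenGraph G₂ ω).induce S).Adj u ⟨P, hPS⟩ :=
      (adj_iff _ _).2 ⟨hPu.1.symm, hu, hP⟩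
    have h2 : ((siteOpenGraph G₂ ω).induce S).Adj ⟨P, hPS⟩ v :=
      (adj_iff _ _).2 ⟨hPu.2, hP, hv⟩
    exact h1.reachable.trans h2.reachable
  · exact SimpleGraph.Adj.reachable ((adj_iff _ _).2 ⟨hG hadj hac, hu, hv⟩)

/-! ### The diagonal flip: edges away from the two diagonals are common to `G` and `flip G` -/

/-- Every edge of the flipped graph other than the new diagonal `BD` is an edge of `G`.
[folklore] -/
theorem flipGraph_adj_imp (G : SimpleGraph V) (A B C D : V) ⦃x y : V⦄
    (h : (flipGraph G A B C D).Adj x y) (hne : s(x, y) ≠ s(B, D)) : G.Adj x y := by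
  rcases (flipGraph_adj G A B C D x y).1 h with ⟨hG, -⟩ | ⟨hBD, -⟩
  · exact hG
  · exact absurd hBD.symm hne

/-- Every edge of `G` other than the old diagonal `AC` is an edge of the flipped graph.
[folklore] -/
theorem adj_flipGraph_of_ne (G : SimpleGraph V) (A B C D : V) ⦃x y : V⦄
    (h : G.Adj x y) (hne : s(x, y) ≠ s(A, C)) : (flipGraph G A B C D).Adj x y :=
  (flipGraph_adj G A B C D x y).2 (Or.inl ⟨h, hne⟩)

/-! ### Localisation of the change of a crossing event -/

/-- **What the flip can create.** For a quadrilateral `ABCD` of `G` (edges `AB`, `AD`, `CB`, `CD`)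
with `A, C` in the domain `S`: a configuration that has a crossing `{∃ u ∈ X, ∃ v ∈ Y, u ⟷ v in S}`
in the flipped graph (diagonal `BD`) but not in `G` (diagonal `AC`) has `B, D` open and `A, C`
closed — the event `E_BD` is a four-arm-type cylinder at `Q`. [folklore] -/
theorem crossing_flipGraph_sdiff_subset {G : SimpleGraph V} {A B C D : V} {S : Set V}
    (X Y : Set V) (hAS : A ∈ S) (hCS : C ∈ S) (hAB : G.Adj A B) (hAD : G.Adj A D)
    (hCB : G.Adj C B) (hCD : G.Adj C D) :
    {ω : SiteConfig V | ∃ u ∈ X, ∃ v ∈ Y, ω ∈ siteConnIn (flipGraph G A B C D) S u v} \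
        {ω | ∃ u ∈ X, ∃ v ∈ Y, ω ∈ siteConnIn G S u v}
      ⊆ {ω | B ∈ ω ∧ D ∈ ω ∧ A ∉ ω ∧ C ∉ ω} := by
  rintro ω ⟨⟨u, hu, v, hv, hω⟩, hnot⟩
  have hG : ∀ ⦃x y : V⦄, (flipGraph G A B C D).Adj x y → s(x, y) ≠ s(B, D) → G.Adj x y :=
    flipGraph_adj_imp G A B C D
  have give : ω ∈ siteConnIn G S u v → False := fun h => hnot ⟨u, hu, v, hv, h⟩
  refine ⟨?_, ?_, fun hA => ?_, fun hC => ?_⟩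
  · by_contra hB
    exact give (siteConnIn_subset_of_adj_of_ne_of_not_mem hG (Or.inl hB) hω)
  · by_contra hD
    exact give (siteConnIn_subset_of_adj_of_ne_of_not_mem hG (Or.inr hD) hω)
  · exact give (siteConnIn_subset_of_adj_of_ne_of_pivot hG hA hAS hAB hAD hω)
  · exact give (siteConnIn_subset_of_adj_of_ne_of_pivot hG hC hCS hCB hCD hω)

/-- **What the flip can destroy.** For a quadrilateral `ABCD` of `G` with four distinct vertices
(so that the sides are not the diagonal `AC`) and `B, D` in the domain `S`: a configuration that
has a crossing in `G` (diagonal `AC`) but not in the flipped graph (diagonal `BD`) has `A, C` open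
and `B, D` closed — the event `E_AC`. [folklore] -/
theorem crossing_sdiff_flipGraph_subset {G : SimpleGraph V} {A B C D : V} {S : Set V}
    (X Y : Set V) (hBS : B ∈ S) (hDS : D ∈ S) (hAB : G.Adj A B) (hAD : G.Adj A D)
    (hCB : G.Adj C B) (hCD : G.Adj C D) (hBC : B ≠ C) (hAB' : A ≠ B) (hDC : D ≠ C)
    (hAD' : A ≠ D) :
    {ω : SiteConfig V | ∃ u ∈ X, ∃ v ∈ Y, ω ∈ siteConnIn G S u v} \
        {ω | ∃ u ∈ X, ∃ v ∈ Y, ω ∈ siteConnIn (flipGraph G A B C D) S u v}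
      ⊆ {ω | A ∈ ω ∧ C ∈ ω ∧ B ∉ ω ∧ D ∉ ω} := by
  rintro ω ⟨⟨u, hu, v, hv, hω⟩, hnot⟩
  have hG : ∀ ⦃x y : V⦄, G.Adj x y → s(x, y) ≠ s(A, C) → (flipGraph G A B C D).Adj x y :=
    adj_flipGraph_of_ne G A B C D
  have give : ω ∈ siteConnIn (flipGraph G A B C D) S u v → False :=
    fun h => hnot ⟨u, hu, v, hv, h⟩
  -- the sides of the quadrilateral survive the flip
  have side : ∀ {P x : V}, G.Adj P x → s(P, x) ≠ s(A, C) → (flipGraph G A B C D).Adj P x :=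
    fun h hne => hG h hne
  have hBA : (flipGraph G A B C D).Adj B A := side hAB.symm fun h => by
    rcases Sym2.eq_iff.1 h with ⟨h1, -⟩ | ⟨h1, -⟩
    · exact hAB' h1.symm
    · exact hBC h1
  have hBC₂ : (flipGraph G A B C D).Adj B C := side hCB.symm fun h => by
    rcases Sym2.eq_iff.1 h with ⟨h1, -⟩ | ⟨h1, -⟩
    · exact hAB' h1.symm
    · exact hBC h1
  have hDA : (flipGraph G A B C D).Adj D A := side hAD.symm fun h => by
    rcases Sym2.eq_iff.1 h with ⟨h1, -⟩ | ⟨h1, -⟩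
    · exact hAD' h1.symm
    · exact hDC h1
  have hDC₂ : (flipGraph G A B C D).Adj D C := side hCD.symm fun h => by
    rcases Sym2.eq_iff.1 h with ⟨h1, -⟩ | ⟨h1, -⟩
    · exact hAD' h1.symm
    · exact hDC h1
  refine ⟨?_, ?_, fun hB => ?_, fun hD => ?_⟩
  · by_contra hA
    exact give (siteConnIn_subset_of_adj_of_ne_of_not_mem hG (Or.inl hA) hω)
  · by_contra hC
    exact give (siteConnIn_subset_of_adj_of_ne_of_not_mem hG (Or.inr hC) hω)
  · exact give (siteConnIn_subset_of_adj_of_ne_of_pivot hG hB hBS hBA hBC₂ hω)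
  · exact give (siteConnIn_subset_of_adj_of_ne_of_pivot hG hD hDS hDA hDC₂ hω)

/-- The same two inclusions for a flippable quadrilateral (`IsFlippableQuad`) lying in the
domain `S`. [folklore] -/
theorem IsFlippableQuad.crossing_symmDiff_subset {G : SimpleGraph V} {A B C D : V} {S : Set V}
    (h : IsFlippableQuad G A B C D) (X Y : Set V) (hAS : A ∈ S) (hBS : B ∈ S) (hCS : C ∈ S)
    (hDS : D ∈ S) :
    ({ω : SiteConfig V | ∃ u ∈ X, ∃ v ∈ Y, ω ∈ siteConnIn (flipGraph G A B C D) S u v} \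
        {ω | ∃ u ∈ X, ∃ v ∈ Y, ω ∈ siteConnIn G S u v}
      ⊆ {ω | B ∈ ω ∧ D ∈ ω ∧ A ∉ ω ∧ C ∉ ω}) ∧
    ({ω : SiteConfig V | ∃ u ∈ X, ∃ v ∈ Y, ω ∈ siteConnIn G S u v} \
        {ω | ∃ u ∈ X, ∃ v ∈ Y, ω ∈ siteConnIn (flipGraph G A B C D) S u v}
      ⊆ {ω | A ∈ ω ∧ C ∈ ω ∧ B ∉ ω ∧ D ∉ ω}) := by
  obtain ⟨hAB', _, hAD', hBC, _, hCD', hAB, hBCadj, hCD, hDA, -, -⟩ := h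
  exact ⟨crossing_flipGraph_sdiff_subset X Y hAS hCS hAB hDA.symm hBCadj.symm hCD,
    crossing_sdiff_flipGraph_subset X Y hBS hDS hAB hDA.symm hBCadj.symm hCD hBC hAB'
      (fun h => hCD' h.symm) hAD'⟩

/-! ### The flip response as a difference of two four-arm probabilities -/

/-- **`Δ_Q(U) = P[U(flip G) ∖ U(G)] − P[U(G) ∖ U(flip G)]`** for measurable events: the flip
response of `U` is the probability of what the flip creates minus the probability of what it
destroys (both four-arm-type events at `Q` for crossing events, by the inclusions above).
[folklore] -/
theorem flipResponse_eq_real_sdiff_sub (G : SimpleGraph V) (A B C D : V)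
    (U : SimpleGraph V → Set (SiteConfig V)) (p : unitInterval) (hU : MeasurableSet (U G))
    (hU' : MeasurableSet (U (flipGraph G A B C D))) :
    flipResponse G A B C D U p =
      (sitePercolation V p).real (U (flipGraph G A B C D) \ U G) -
        (sitePercolation V p).real (U G \ U (flipGraph G A B C D)) := by
  rw [flipResponse_def]
  change (sitePercolation V p).real (U (flipGraph G A B C D)) - (sitePercolation V p).real (U G) = _
  rw [← measureReal_inter_add_sdiff (μ := sitePercolation V p) (s := U (flipGraph G A B C D)) hU,
    ← measureReal_inter_add_sdiff (μ := sitePercolation V p) (s := U G) hU', Set.inter_comm (U G)]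
  ring

/-- Consequently `|Δ_Q(U)|` is at most the larger of the two four-arm-type probabilities, and in
particular at most their sum. [folklore] -/
theorem abs_flipResponse_le_real_sdiff_add (G : SimpleGraph V) (A B C D : V)
    (U : SimpleGraph V → Set (SiteConfig V)) (p : unitInterval) (hU : MeasurableSet (U G))
    (hU' : MeasurableSet (U (flipGraph G A B C D))) :
    |flipResponse G A B C D U p| ≤
      (sitePercolation V p).real (U (flipGraph G A B C D) \ U G) +
        (sitePercolation V p).real (U G \ U (flipGraph G A B C D)) := by
  rw [flipResponse_eq_real_sdiff_sub G A B C D U p hU hU', abs_sub_le_iff]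
  constructor <;> linarith [measureReal_nonneg (μ := sitePercolation V p)
      (s := U (flipGraph G A B C D) \ U G),
    measureReal_nonneg (μ := sitePercolation V p) (s := U G \ U (flipGraph G A B C D))]

end Summit.CriticalPhenomena.CardyFormulaZ2.Theorems

end
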